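import Summits.AtomisticToContinuum.BoseEinsteinCondensation.Theses.BECThomsonPrinciple
import Summits.AtomisticToContinuum.BoseEinsteinCondensation.Theorems.PeriodicToDirichlet.Negative.RewardedFreeGasSlab
import Literature.MathematicalPhysics.QuantumManyBody.ThermalExpectation

/-!
# Negative lemmas for crux `PeriodicToDirichlet` (stmt-AtomisticToContinuum-9483), rewarded free gas II:
the flat-mode cap `flatCap < 1` of the free Dirichlet near-minimisers at `λ = 0`

Supports (does not close) stmt-AtomisticToContinuum-9483 (crux `PeriodicToDirichlet`, route
`BECThomsonPrinciple`), line `reward-pays-the-wall`, stub `Unrewarding` (skeleton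
`Cruxes/PeriodicToDirichlet/Lines/reward-pays-the-wall.lean`, not an importable module: its
reward vocabulary is copied verbatim in part II). Filed by the crux disprover (gen 3). Series:
I `RewardedFreeGasSlab` (translation/slab/one-body flat overlap) and III `RewardedFreeGasPlateau`
(plateau modes) are independent; II `RewardedFreeGasCap` (flat mode, `N`-body bound, the cap
`flatCap < 1` at `λ = 0`, reward vocabulary) imports I; IV `RewardedFreeGasAnchors` (rewarded
anchors for every `c < 1` at `v = 0`; `¬ UnrewardingSameConstant`) imports II and III.

This part (all `[folklore]`, sorry-free):
* `flatMode L := boxConstantMode L` (the tree's `φ_L = L^{-3/2}1_{Λ_L}`, as in the lead's reshaped skeleton),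
  `integral_conj_flatMode_mul`, `ennnorm_integral_conj_flatMode_mul_sq`;
* `occupation_flatMode_le` — `N` BODIES: `n_φ(Ψ) ≤ (2L/(2L+s)) (N + s² T(Ψ))` for every Dirichlet
  trial state of `Λ_L`, `0 < s ≤ L` (`flatOverlap_sq_le` on each slice `x ↦ Ψ(x,Y)`, integrated,
  times `N` by Bose symmetry `T = N∫|∇₀Ψ|²`);
* `exists_flatCap` / `flatCap` / `flatCap_lt_one` / `flatCap_spec` — a universal `c₁ < 1` such
  that at EVERY `N ≥ 1`, `L > 0` and slack `δ > 0` some `δ`-near-minimiser of the free Dirichlet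
  energy has flat occupation `< c₁N` (crude but checked: `E₀^D(0,N,L) ≤ N𝓔₀[β]/L²` by the unit
  bump, then `s = L/(4(𝓔₀[β]+1))`; the truth is `(8/π²)³ = 0.5326`, the flat content of
  `∏ sin(πxᵢ/L)`);
* the reward vocabulary of the lead's skeleton, VERBATIM up to unfolding the abbreviation `flatMode`:
  `rewardedEnergy`, `rewardedInf`, `RewardedBoxBECAt`, `Unrewarding` (stub 4), and its natural strengthening
  `UnrewardingSameConstant` (`c' = c`); `rewardedEnergy_of_nonpos`, `rewardedInf_of_nonpos`;
* `not_rewardedBoxBECAt_zero_flatCap` — at `λ = 0`, flat-mode BEC of the free Dirichlet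
  near-minimisers FAILS with constant `flatCap`, at every density.
-/

noncomputable section

open MeasureTheory Filter Set Metric
open scoped ENNReal NNReal ComplexConjugate Topology

namespace Summit.AtomisticToContinuum.BoseEinsteinCondensation.Theorems.PeriodicToDirichlet.Negative

open Literature.MathematicalPhysics.QuantumManyBody.BoseGas

/-! ## §3 The flat mode; `N` bodies: flat-mode occupation of low-energy Dirichlet states; the cap at `λ = 0` -/

/-- The flat mode of the line is the tree's `boxConstantMode L = L^{-3/2} 1_{Λ_L}`
(`ThermalExpectation.lean`; the lead's reshaped skeleton `Lines/reward-pays-the-wall.lean` uses it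
verbatim, the planner's original `RewardPaysTheWall.flatMode` had the identical body). Local
abbreviation. [folklore] -/
abbrev flatMode (L : ℝ) : Space → ℂ := boxConstantMode L

/-- The flat-mode pairing is `L^{-3/2} ∫_{Λ_L} u`. [folklore] -/
theorem integral_conj_flatMode_mul (L : ℝ) (u : Space → ℂ) :
    ∫ x, conj (flatMode L x) * u x = ((Real.sqrt (L ^ 3))⁻¹ : ℂ) * ∫ x in box L, u x := by
  have h : (fun x => conj (flatMode L x) * u x) =
      (box L).indicator fun x => ((Real.sqrt (L ^ 3))⁻¹ : ℂ) * u x := by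
    funext x
    unfold flatMode boxConstantMode
    by_cases hx : x ∈ box L
    · rw [Set.indicator_of_mem hx, Set.indicator_of_mem hx, ← Complex.ofReal_inv,
        Complex.conj_ofReal]
    · rw [Set.indicator_of_notMem hx, Set.indicator_of_notMem hx, map_zero, zero_mul]
  rw [h, integral_indicator (measurableSet_box L), integral_const_mul]

/-- The flat-mode pairing squared is `L⁻³ |∫_Λ u|²`. [folklore] -/
theorem ennnorm_integral_conj_flatMode_mul_sq {L : ℝ} (hL : 0 < L) (u : Space → ℂ) :
    (‖∫ x, conj (flatMode L x) * u x‖₊ : ℝ≥0∞) ^ 2 =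
      (ENNReal.ofReal L ^ 3)⁻¹ * (‖∫ x in box L, u x‖₊ : ℝ≥0∞) ^ 2 := by
  rw [integral_conj_flatMode_mul, nnnorm_mul, ENNReal.coe_mul, mul_pow, nnnorm_constantMode_sq hL]


/-- Slices of a Dirichlet trial state vanish off the box. [folklore] -/
theorem slice_eq_zero {n : ℕ} {L : ℝ} (Ψ : TrialState (n + 1) L) (Y : Config n) {x : Space}
    (hx : x ∉ box L) : Ψ.ψ (Matrix.vecCons x Y) = 0 :=
  Ψ.eq_zero _ fun h => hx (by simpa using h 0)

/-- **Flat-mode occupation versus free kinetic energy.** For every Dirichlet trial state `Ψ` of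
`N = n+1` bosons in `Λ_L` and every `0 < s ≤ L`:
`⟨φ_L, γ_Ψ φ_L⟩ ≤ (2L/(2L+s)) (N + s² T(Ψ))`, `T = energy 0` the kinetic energy
(`flatOverlap_sq_le` on each slice `x ↦ Ψ(x, Y)`, integrated over `Y`, times `N` by Bose
symmetry: `T = N ∫|∇₀Ψ|²`). [folklore] -/
theorem occupation_flatMode_le {n : ℕ} {L s : ℝ} (hL : 0 < L) (hs : 0 < s) (hsL : s ≤ L)
    (Ψ : TrialState (n + 1) L) :
    occupation (n + 1) (flatMode L) Ψ.ψ ≤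
      ENNReal.ofReal (2 * L / (2 * L + s)) *
        ((n + 1 : ℝ≥0∞) + ENNReal.ofReal (s ^ 2) * energy 0 Ψ) := by
  set C := ENNReal.ofReal (2 * L / (2 * L + s)) with hC
  have hcont : Continuous Ψ.ψ := Ψ.contDiff.continuous
  have hdiff : Differentiable ℝ Ψ.ψ := Ψ.contDiff.differentiable one_ne_zero
  -- slice-wise bound
  have hslice : ∀ Y : Config n,
      (‖∫ x, conj (flatMode L x) * Ψ.ψ (Matrix.vecCons x Y)‖₊ : ℝ≥0∞) ^ 2 ≤
        C * ((∫⁻ x, (‖Ψ.ψ (Matrix.vecCons x Y)‖₊ : ℝ≥0∞) ^ 2) +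
          ENNReal.ofReal (s ^ 2) * ∫⁻ x, gradSqC (fun y => Ψ.ψ (Matrix.vecCons y Y)) x) := by
    intro Y
    rw [ennnorm_integral_conj_flatMode_mul_sq hL]
    refine (flatOverlap_sq_le hL hs hsL (contDiff_vecCons_slice Ψ.contDiff Y)
      (fun x hx => slice_eq_zero Ψ Y hx)).trans ?_
    gcongr with x
    exact Finset.single_le_sum (f := fun k : Fin 3 =>
      (‖fderiv ℝ (fun y => Ψ.ψ (Matrix.vecCons y Y)) x (EuclideanSpace.single k (1 : ℝ))‖₊ :
        ℝ≥0∞) ^ 2) (fun _ _ => bot_le) (Finset.mem_univ (0 : Fin 3))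
  -- integrate over `Y`
  have hint := lintegral_mono (μ := (volume : Measure (Config n))) hslice
  have hmass : ∫⁻ Y : Config n, ∫⁻ x, (‖Ψ.ψ (Matrix.vecCons x Y)‖₊ : ℝ≥0∞) ^ 2 = 1 := by
    have hF : Measurable fun X : Config (n + 1) => (‖Ψ.ψ X‖₊ : ℝ≥0∞) ^ 2 := measurable_normSq hcont
    have hsw : AEMeasurable (Function.uncurry fun (Y : Config n) (x : Space) =>
        (‖Ψ.ψ (Matrix.vecCons x Y)‖₊ : ℝ≥0∞) ^ 2) (volume.prod volume) :=
      ((hF.comp measurable_vecCons).comp measurable_swap).aemeasurable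
    rw [lintegral_lintegral_swap hsw, lintegral_lintegral_vecCons hF, Ψ.norm_eq]
  have hgrad : Measurable fun Y : Config n =>
      ENNReal.ofReal (s ^ 2) * ∫⁻ x, gradSqC (fun y => Ψ.ψ (Matrix.vecCons y Y)) x :=
    (measurable_lintegral_gradSqC_vecCons hdiff).const_mul _
  have hR : ∫⁻ Y : Config n, C * ((∫⁻ x, (‖Ψ.ψ (Matrix.vecCons x Y)‖₊ : ℝ≥0∞) ^ 2) +
      ENNReal.ofReal (s ^ 2) * ∫⁻ x, gradSqC (fun y => Ψ.ψ (Matrix.vecCons y Y)) x) =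
      C * (1 + ENNReal.ofReal (s ^ 2) * ∫⁻ X, partialGradSq 0 Ψ.ψ X) := by
    rw [lintegral_const_mul' _ _ ENNReal.ofReal_ne_top, lintegral_add_right _ hgrad, hmass,
      lintegral_const_mul' _ _ ENNReal.ofReal_ne_top, lintegral_partialGradSq_zero_eq hdiff]
  rw [hR] at hint
  have hT : (n + 1 : ℝ≥0∞) * ∫⁻ X, partialGradSq 0 Ψ.ψ X = energy 0 Ψ := by
    rw [← lintegral_kineticDensity_eq_mul hdiff Ψ.symm, energy]
    simp
  unfold occupation
  push_cast
  calc (n + 1 : ℝ≥0∞) * ∫⁻ Y : Config n,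
        (‖∫ x, conj (flatMode L x) * Ψ.ψ (Matrix.vecCons x Y)‖₊ : ℝ≥0∞) ^ 2
      ≤ (n + 1 : ℝ≥0∞) * (C * (1 + ENNReal.ofReal (s ^ 2) * ∫⁻ X, partialGradSq 0 Ψ.ψ X)) := by
        gcongr
    _ = C * ((n + 1 : ℝ≥0∞) + ENNReal.ofReal (s ^ 2) * energy 0 Ψ) := by
        rw [← hT]; ring

/-- **The cap constant.** There is a universal `c₁ < 1` such that in EVERY box and for EVERY
particle number, free Dirichlet states arbitrarily close to the ground-state energy with
flat-mode occupation `< c₁ N` exist (in truth the near-minimisers are `≈ ∏ sin`, flat fraction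
`→ (8/π²)³ = 0.5326`; the checked bound is crude: `E₀^D(0,N,L) ≤ N𝓔₀[β]/L²` by the unit bump,
then `occupation_flatMode_le` with `s = L/(4(𝓔₀[β]+1))`). [folklore] -/
theorem exists_flatCap : ∃ c₁ : ℝ, c₁ < 1 ∧ ∀ (n : ℕ) (L : ℝ), 0 < L → ∀ δ : ℝ≥0∞, 0 < δ →
    ∃ Ψ : TrialState (n + 1) L, energy 0 Ψ ≤ groundStateEnergy 0 (n + 1) L + δ ∧
      occupation (n + 1) (flatMode L) Ψ.ψ < ENNReal.ofReal (c₁ * (n + 1)) := by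
  set K : ℝ := (energy 0 unitBump).toReal with hK
  have hK0 : 0 ≤ K := ENNReal.toReal_nonneg
  set a : ℝ := K + 1 with ha
  have ha1 : 1 ≤ a := by linarith
  set σ : ℝ := 1 / (4 * a) with hσ
  have hσpos : 0 < σ := by positivity
  have hσle : σ ≤ 1 := by
    rw [hσ, div_le_one (by positivity)]; linarith
  set cstar : ℝ := (2 + σ / 2) / (2 + σ) with hcstar
  have hcstar1 : cstar < 1 := by
    rw [hcstar, div_lt_one (by positivity)]; linarith
  refine ⟨(1 + cstar) / 2, by linarith, fun n L hL δ hδ => ?_⟩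
  have hKtop : energy 0 unitBump ≠ ⊤ := energy_unitBump_lt_top.ne
  have hKeq : energy 0 unitBump = ENNReal.ofReal K := (ENNReal.ofReal_toReal hKtop).symm
  -- the ground-state energy is finite
  have hE0le : groundStateEnergy 0 (n + 1) L ≤ ENNReal.ofReal ((n + 1) * K / L ^ 2) := by
    refine (groundStateEnergy_zero_le hL (n + 1)).trans (le_of_eq ?_)
    rw [hKeq, show ((n + 1 : ℕ) : ℝ≥0∞) = ENNReal.ofReal (n + 1) by
        rw [← Nat.cast_succ, ENNReal.ofReal_natCast],
      ← ENNReal.ofReal_mul (by positivity), ENNReal.ofReal_inv_of_pos (by positivity),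
      ← ENNReal.div_eq_inv_mul, ← ENNReal.ofReal_div_of_pos (by positivity)]
  have hE0top : groundStateEnergy 0 (n + 1) L ≠ ⊤ := ne_top_of_le_ne_top ENNReal.ofReal_ne_top hE0le
  -- a near-minimiser within `min δ (N/L²)`
  set δ' : ℝ≥0∞ := min δ (ENNReal.ofReal ((n + 1) / L ^ 2)) with hδ'
  have hδ'pos : 0 < δ' := lt_min hδ (by rw [ENNReal.ofReal_pos]; positivity)
  obtain ⟨Ψ, hΨ⟩ := iInf_lt_iff.mp (ENNReal.lt_add_right hE0top hδ'pos.ne')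
  refine ⟨Ψ, hΨ.le.trans (add_le_add le_rfl (min_le_left _ _)), ?_⟩
  -- its energy is `≤ (n+1) a / L²`
  have hEΨ : energy 0 Ψ ≤ ENNReal.ofReal ((n + 1) * a / L ^ 2) := by
    calc energy 0 Ψ ≤ groundStateEnergy 0 (n + 1) L + δ' := hΨ.le
      _ ≤ ENNReal.ofReal ((n + 1) * K / L ^ 2) + ENNReal.ofReal ((n + 1) / L ^ 2) :=
          add_le_add hE0le (min_le_right _ _)
      _ = ENNReal.ofReal ((n + 1) * a / L ^ 2) := by
          rw [← ENNReal.ofReal_add (by positivity) (by positivity)]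
          congr 1
          rw [ha]; ring
  -- the occupation bound with `s = σ L`
  have hs : 0 < σ * L := by positivity
  have hsL : σ * L ≤ L := by nlinarith
  have hocc := occupation_flatMode_le hL hs hsL Ψ
  have hreal : ENNReal.ofReal (2 * L / (2 * L + σ * L)) *
      ((n + 1 : ℝ≥0∞) + ENNReal.ofReal ((σ * L) ^ 2) * ENNReal.ofReal ((n + 1) * a / L ^ 2)) =
      ENNReal.ofReal (cstar * (n + 1)) := by
    rw [show ((n : ℝ≥0∞) + 1) = ENNReal.ofReal (n + 1) by
        rw [← Nat.cast_succ (R := ℝ), ENNReal.ofReal_natCast, Nat.cast_succ],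
      ← ENNReal.ofReal_mul (by positivity), ← ENNReal.ofReal_add (by positivity) (by positivity),
      ← ENNReal.ofReal_mul (by positivity)]
    congr 1
    rw [hcstar, hσ]
    field_simp
    ring
  calc occupation (n + 1) (flatMode L) Ψ.ψ
      ≤ ENNReal.ofReal (2 * L / (2 * L + σ * L)) *
          ((n + 1 : ℝ≥0∞) + ENNReal.ofReal ((σ * L) ^ 2) * energy 0 Ψ) := hocc
    _ ≤ ENNReal.ofReal (2 * L / (2 * L + σ * L)) *
          ((n + 1 : ℝ≥0∞) + ENNReal.ofReal ((σ * L) ^ 2) * ENNReal.ofReal ((n + 1) * a / L ^ 2)) := by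
        gcongr
    _ = ENNReal.ofReal (cstar * (n + 1)) := hreal
    _ < ENNReal.ofReal ((1 + cstar) / 2 * (n + 1)) := by
        rw [ENNReal.ofReal_lt_ofReal_iff (by positivity)]
        have : (0 : ℝ) < n + 1 := by positivity
        nlinarith

/-- The universal flat-mode cap `c₁ < 1` of `exists_flatCap`. [folklore] -/
def flatCap : ℝ := exists_flatCap.choose

/-- `c₁ < 1`. [folklore] -/
theorem flatCap_lt_one : flatCap < 1 := exists_flatCap.choose_spec.1

/-- The defining property of `c₁`. [folklore] -/
theorem flatCap_spec {n : ℕ} {L : ℝ} (hL : 0 < L) {δ : ℝ≥0∞} (hδ : 0 < δ) :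
    ∃ Ψ : TrialState (n + 1) L, energy 0 Ψ ≤ groundStateEnergy 0 (n + 1) L + δ ∧
      occupation (n + 1) (flatMode L) Ψ.ψ < ENNReal.ofReal (flatCap * (n + 1)) :=
  exists_flatCap.choose_spec.2 n L hL δ hδ


/-! ## §4 The reward vocabulary (verbatim copies of the skeleton) and the cap at `λ = 0` -/

/-- COPY of `RewardPaysTheWall.rewardedEnergy`: `R_λ(Ψ) = ⟨Ψ,HΨ⟩ + λ(N − n_φ(Ψ))`. [folklore] -/
def rewardedEnergy (v : ℝ → ℝ≥0∞) (lam : ℝ) {N : ℕ} {L : ℝ} (Ψ : TrialState N L) : ℝ≥0∞ :=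
  energy v Ψ + ENNReal.ofReal lam * ((N : ℝ≥0∞) - occupation N (flatMode L) Ψ.ψ)

/-- COPY of `RewardPaysTheWall.rewardedInf`: `F^D(λ; N, L) = inf_Ψ R_λ(Ψ)`. [folklore] -/
def rewardedInf (v : ℝ → ℝ≥0∞) (lam : ℝ) (N : ℕ) (L : ℝ) : ℝ≥0∞ :=
  ⨅ Ψ : TrialState N L, rewardedEnergy v lam Ψ

/-- COPY of `RewardPaysTheWall.RewardedBoxBECAt`: rewarded flat-mode BEC of the Dirichlet
near-minimisers at `(v, ρ, λ, c)` (a statement of the line's proof plan, deliberately untagged,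
not a result in print). -/
def RewardedBoxBECAt (v : ℝ → ℝ≥0∞) (ρ lam c : ℝ) : Prop :=
  ∀ᶠ N : ℕ in atTop, ∃ δ : ℝ≥0∞, 0 < δ ∧
    ∀ Ψ : TrialState N (sideLength ρ N),
      rewardedEnergy v lam Ψ ≤ rewardedInf v lam N (sideLength ρ N) + δ →
        ENNReal.ofReal (c * N) ≤ occupation N (flatMode (sideLength ρ N)) Ψ.ψ

/-- COPY of `RewardPaysTheWall.Unrewarding` (stub 4 of the line, the hardest; a statement of the
line's proof plan, deliberately untagged, not a result in print). -/
def Unrewarding : Prop :=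
  ∀ v : ℝ → ℝ≥0∞, IsRepulsiveFiniteRange v → ∃ ρ₃ : ℝ, 0 < ρ₃ ∧ ∀ ρ : ℝ, 0 < ρ → ρ < ρ₃ →
    ∀ c : ℝ, 0 < c → (∀ lam : ℝ, 0 < lam → RewardedBoxBECAt v ρ lam c) →
      ∃ c' : ℝ, 0 < c' ∧ RewardedBoxBECAt v ρ 0 c'

/-- The NATURAL STRENGTHENING of stub 4 in which un-rewarding keeps the constant (`c' = c`);
refuted below/in part IV at `v = 0` (deliberately untagged: a hypothesis shape, not a result in
print). -/
def UnrewardingSameConstant : Prop :=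
  ∀ v : ℝ → ℝ≥0∞, IsRepulsiveFiniteRange v → ∃ ρ₃ : ℝ, 0 < ρ₃ ∧ ∀ ρ : ℝ, 0 < ρ → ρ < ρ₃ →
    ∀ c : ℝ, 0 < c → (∀ lam : ℝ, 0 < lam → RewardedBoxBECAt v ρ lam c) →
      RewardedBoxBECAt v ρ 0 c

/-- A non-positive reward is no reward. [folklore] -/
theorem rewardedEnergy_of_nonpos (v : ℝ → ℝ≥0∞) {lam : ℝ} (h : lam ≤ 0) {N : ℕ} {L : ℝ}
    (Ψ : TrialState N L) : rewardedEnergy v lam Ψ = energy v Ψ := by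
  simp [rewardedEnergy, ENNReal.ofReal_of_nonpos h]

/-- … so `F^D(λ) = E₀^D` for `λ ≤ 0`. [folklore] -/
theorem rewardedInf_of_nonpos (v : ℝ → ℝ≥0∞) {lam : ℝ} (h : lam ≤ 0) (N : ℕ) (L : ℝ) :
    rewardedInf v lam N L = groundStateEnergy v N L := by
  simp [rewardedInf, rewardedEnergy_of_nonpos v h, groundStateEnergy]

/-- **The conclusion of stub 4 fails at `v = 0` for the constant `c₁ < 1`** (at every density):
flat-mode BEC of the free Dirichlet near-minimisers holds at best with a constant `< c₁`
(`flatCap_spec`: at every `N ≥ 1` and every slack there is a near-minimiser with flat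
occupation `< c₁N`). [folklore] -/
theorem not_rewardedBoxBECAt_zero_flatCap {ρ : ℝ} (hρ : 0 < ρ) :
    ¬ RewardedBoxBECAt 0 ρ 0 flatCap := by
  intro h
  obtain ⟨N, hN, δ, hδ, hΨ⟩ := ((eventually_gt_atTop 0).and h).exists
  obtain ⟨n, rfl⟩ : ∃ n, N = n + 1 := ⟨N - 1, by omega⟩
  have hL : 0 < sideLength ρ (n + 1) := sideLength_pos_of_pos hρ hN
  obtain ⟨Ψ, hE, hocc⟩ := flatCap_spec (n := n) hL hδ
  have h1 := hΨ Ψ (by rwa [rewardedEnergy_of_nonpos 0 le_rfl, rewardedInf_of_nonpos 0 le_rfl])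
  push_cast at h1
  exact absurd h1 (not_le.2 hocc)

end Summit.AtomisticToContinuum.BoseEinsteinCondensation.Theorems.PeriodicToDirichlet.Negative

end
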